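import Summits.ResolutionOfSingularities.ResolutionOfSingularities.Theorems.HomologicalConductorNoZenoRFirstKindNotFibre
import Mathlib.RingTheory.RegularLocalRing.Defs
import HarnessLib

/-!
# Crux `NoZenoR` (stmt-ResolutionOfSingularities-19943) — over a NON-REGULAR rational surface singularity EVERY
# first-kind exceptional curve `E` has `(Z·E) = 0` for the cycle `Z` of `𝔪𝒪_X` (unconditional form)

Route `ResolutionOfSingularities/HomologicalConductor` (cell decomp-res, hand leafhand-res-homologicalconduct-24 g0).
OURS: AI-written proof over tree theorems and Mathlib, weaker than expert review; nothing here is a statement of the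
manuscript under review (Hironaka 2017).  SUPPORT level, counted 0.  Def-free, fact-free.

Sequel of `…NoZenoRFirstKindNotFibre` (the same conclusion under `4 ≤ ℓ_S(S/𝔪²)`).  Here the commutative algebra
`ℓ_S(S/𝔪²) = 1 + dim_k(𝔪/𝔪²)` and `dim_k(𝔪/𝔪²) ≥ 3` for a non-regular Noetherian local ring of dimension `2`
(Mathlib: `IsRegularLocalRing.of_spanFinrank_maximalIdeal_le`, `spanFinrank_maximalIdeal_eq_finrank_cotangentSpace`)
removes that hypothesis:

* `length_quotient_maximalIdeal_sq` — `ℓ_S(S/𝔪²) = ℓ_S(𝔪/𝔪²) + 1` (`0 → 𝔪/𝔪² → S/𝔪² → S/𝔪 → 0`);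
* `length_cotangentSpace_eq_finrank` — `ℓ_S(𝔪/𝔪²) = dim_k(𝔪/𝔪²)`;
* `four_le_length_quotient_maximalIdeal_sq` — `4 ≤ ℓ_S(S/𝔪²)` for `S` Noetherian local of dimension `2`, not regular;
* **`excCurveDegree_baseIdeal_eq_zero_of_firstKind'`** — `S` a two-dimensional Noetherian local normal domain with a
  rational singularity, NOT regular, `π : X → Spec S` a desingularization, `E_η` an integral exceptional curve of the
  first kind (`h⁰(𝓘_η²) = 3·h⁰(𝓘_η)`), `Z` the cycle of the invertible ideal `𝔪𝒪_X`: **`(Z·E_η) = 0`**;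
* `baseIdeal_ne_primeDivisorIdeal_of_firstKind'` — and `𝔪𝒪_X ≠ 𝓘_η`.

Meaning for the road to Lipman (27.3) «⇒» / (27.1) without Castelnuovo (memo MEMO-19943-hand24g0-M0-ROAD.md): a
first-kind curve on a desingularization of a non-regular rational `S` is NUMERICALLY contracted by the domination
`X → Bl_𝔪 Spec S` (Lipman (*), p. 203); what remains for «the minimal desingularization has no first-kind curve» is
the geometric reading `(Z·E_η) = 0 ⇒ σ(η)` closed in `Bl_𝔪 Spec S` and the localisation of minimality over the
quadratic transform.  No crux or summit statement is proved here.
-/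

noncomputable section

-- single-problem summit: the doubled namespace component `ResolutionOfSingularities` is forced
set_option linter.dupNamespace false

open CategoryTheory CategoryTheory.Limits AlgebraicGeometry TopologicalSpace IsLocalRing
open Literature.AlgebraicGeometry.Resolution Literature.AlgebraicGeometry.Motives

namespace Summit.ResolutionOfSingularities.ResolutionOfSingularities.Theorems.NoZeno.FirstKind

/-! ## §1 Commutative algebra: `ℓ_S(S/𝔪²) = 1 + dim_k 𝔪/𝔪² ≥ 4` for a non-regular local ring of dimension `2` -/

section Algebra

variable (S : Type*) [CommRing S] [IsLocalRing S]

/-- `ℓ_S(S/𝔪²) = ℓ_S(𝔪/𝔪²) + 1`: the exact sequence `0 → 𝔪/𝔪² → S/𝔪² → S/𝔪 → 0` and `ℓ_S(S/𝔪) = 1`. [folklore] -/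
theorem length_quotient_maximalIdeal_sq :
    Module.length S (S ⧸ maximalIdeal S ^ 2) = Module.length S (CotangentSpace S) + 1 := by
  have hle : maximalIdeal S ^ 2 ≤ maximalIdeal S := Ideal.pow_le_self two_ne_zero
  have hex : Function.Exact (maximalIdeal S).cotangentToQuotientSquare (Submodule.factor hle) := by
    rw [LinearMap.exact_iff, Ideal.range_cotangentToQuotientSquare, Submodule.ker_mapQ, Submodule.comap_id]
    ext x
    simp only [Submodule.restrictScalars_mem, Ideal.cotangentIdeal, Submodule.mem_map]
    constructor
    · rintro ⟨y, hy, rfl⟩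
      exact ⟨y, hy, rfl⟩
    · rintro ⟨y, hy, rfl⟩
      exact ⟨y, hy, rfl⟩
  haveI : IsSimpleModule S (S ⧸ maximalIdeal S) :=
    (isSimpleModule_iff_isCoatom).mpr (Ideal.isMaximal_def.mp (maximalIdeal.isMaximal S))
  rw [Module.length_eq_add_of_exact _ _ (Ideal.cotangentToQuotientSquare_injective _)
    (Submodule.factor_surjective hle) hex, Module.length_eq_one S (S ⧸ maximalIdeal S)]

/-- `ℓ_S(𝔪/𝔪²) = dim_k(𝔪/𝔪²)` (the `S`-module `𝔪/𝔪²` is a `k = S/𝔪`-vector space). [folklore] -/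
theorem length_cotangentSpace_eq_finrank [IsNoetherianRing S] :
    Module.length S (CotangentSpace S) = Module.finrank (ResidueField S) (CotangentSpace S) := by
  rw [Module.length_eq_of_surjective (S := S) (R := ResidueField S) (M := CotangentSpace S)
    IsLocalRing.residue_surjective, Module.length_eq_finrank]

/-- **`4 ≤ ℓ_S(S/𝔪²)` for a NON-regular Noetherian local ring of dimension `2`**: regularity would follow from
`dim_k 𝔪/𝔪² ≤ 2 = dim S` (`IsRegularLocalRing.of_spanFinrank_maximalIdeal_le`), so `dim_k 𝔪/𝔪² ≥ 3`.
[cite: StacksProject, Tag 00KU] -/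
theorem four_le_length_quotient_maximalIdeal_sq [IsNoetherianRing S] (hdim : ringKrullDim S = 2)
    (hsing : ¬ IsRegularLocalRing S) : 4 ≤ Module.length S (S ⧸ maximalIdeal S ^ 2) := by
  have h : ¬ ((maximalIdeal S).spanFinrank : WithBot ℕ∞) ≤ ringKrullDim S :=
    fun hle => hsing (IsRegularLocalRing.of_spanFinrank_maximalIdeal_le S hle)
  rw [hdim, not_le, spanFinrank_maximalIdeal_eq_finrank_cotangentSpace] at h
  have h3 : 3 ≤ Module.finrank (ResidueField S) (CotangentSpace S) := by
    have h' : (2 : WithBot ℕ∞) < (Module.finrank (ResidueField S) (CotangentSpace S) : ℕ) := h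
    have : (2 : ℕ) < Module.finrank (ResidueField S) (CotangentSpace S) := by exact_mod_cast h'
    omega
  rw [length_quotient_maximalIdeal_sq, length_cotangentSpace_eq_finrank]
  have h3' : (3 : ℕ∞) ≤ (Module.finrank (ResidueField S) (CotangentSpace S) : ℕ∞) := by exact_mod_cast h3
  calc (4 : ℕ∞) = 3 + 1 := by norm_num
    _ ≤ (Module.finrank (ResidueField S) (CotangentSpace S) : ℕ∞) + 1 := add_le_add h3' le_rfl

end Algebra

/-! ## §2 Every first-kind curve is numerically contracted by the quadratic transform -/

section Geometry

variable {S : Type} [CommRing S] [IsNoetherianRing S] [IsLocalRing S] [IsDomain S] [IsIntegrallyClosed S]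
  {X : Scheme.{0}} (π : X ⟶ Spec (.of S))

/-- **`𝔪𝒪_X ≠ 𝓘_η` for a first-kind curve `E_η`** on a desingularization of a NON-regular rational `S` (the closed
fibre is never a reduced first-kind curve): `…NotFibre.baseIdeal_ne_primeDivisorIdeal_of_firstKind` with
`4 ≤ ℓ_S(S/𝔪²)` supplied by `four_le_length_quotient_maximalIdeal_sq`.
[cite: Lipman1969, Proposition (3.1) (p. 203); Theorem (7.2) (p. 209)] -/
theorem baseIdeal_ne_primeDivisorIdeal_of_firstKind' (hdim : ringKrullDim S = 2)
    (hrat : HasRationalSingularity S) (hsing : ¬ IsRegularLocalRing S) (hπ : IsResolution π) {η : X}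
    (hfk : h0 π (primeDivisorIdeal η ^ 2) = 3 * h0 π (primeDivisorIdeal η)) :
    Scheme.IdealSheafData.ofIdealTop ((maximalIdeal S).map
        (Literature.AlgebraicGeometry.Morphisms.algebraMapΓ π)) ≠ primeDivisorIdeal η :=
  baseIdeal_ne_primeDivisorIdeal_of_firstKind π hdim hrat hsing hπ
    (four_le_length_quotient_maximalIdeal_sq S hdim hsing) hfk

/-- **MAIN — every first-kind curve is numerically contracted by `X → Bl_𝔪 Spec S`.**  `S` a two-dimensional
Noetherian local normal domain with a rational singularity, NOT regular; `π : X → Spec S` a desingularization; `Z` the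
cycle of the invertible ideal `𝔪𝒪_X` (Lipman Prop. (3.1)); `E_η` an integral exceptional curve of the first kind
(`h⁰(𝓘_η²) = 3·h⁰(𝓘_η)`).  Then `(Z·E_η) = 0`.  (Numerical core `…FirstKindCycle` + base-ideal product
`…FirstKindBaseCycle` + `𝔪²` contracted `…FirstKindNotFibre` + §1.)
[cite: Lipman1969, Proposition (3.1) (p. 203); Theorem (7.2) (p. 209); Proposition (13.1) (p. 223)] -/
theorem excCurveDegree_baseIdeal_eq_zero_of_firstKind' [IsIntegral X] [IsLocallyNoetherian X]
    (hdim : ringKrullDim S = 2) (hrat : HasRationalSingularity S) (hsing : ¬ IsRegularLocalRing S)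
    (hπ : IsResolution π) {η : X} (hη : η ∈ excCurvePoints π)
    (hfk : h0 π (primeDivisorIdeal η ^ 2) = 3 * h0 π (primeDivisorIdeal η))
    (hJ : IsEffectiveCartier (Scheme.IdealSheafData.ofIdealTop ((maximalIdeal S).map
      (Literature.AlgebraicGeometry.Morphisms.algebraMapΓ π)))) :
    excCurveDegree π (CartierDivisor.ofIsEffectiveCartier _ hJ) η = 0 :=
  excCurveDegree_baseIdeal_eq_zero_of_firstKind π hdim hrat hsing hπ
    (four_le_length_quotient_maximalIdeal_sq S hdim hsing) hη hfk hJ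

end Geometry

end Summit.ResolutionOfSingularities.ResolutionOfSingularities.Theorems.NoZeno.FirstKind

end
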